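import Summits.CriticalPhenomena.PercolationContinuityZ3.Theorems.PercNearOneGluingNoHeavyQuantTiedCoreCoupling
import Summits.CriticalPhenomena.PercolationContinuityZ3.Theorems.PercNearOneGluingNoHeavyQuantThreeRootGenericStep
import Summits.CriticalPhenomena.PercolationContinuityZ3.Theorems.PercNearOneGluingNoHeavyQuantThreeRootGateStep
import Summits.CriticalPhenomena.PercolationContinuityZ3.Theorems.PercNearOneGluingNoHeavyQuantForestData
import HarnessLib

/-!
# QUANT lane R8, T-DEC: THE TIED-CORE GATE STEP FROM THE ORACLE — the DEC consequence of the tied-core coupling identity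
# (`…QuantTiedCoreCoupling`, `tiedCore_gateCoupling_general`) inside the binder of `LawDec.GateStepN`, i.e. a solved sub-case of the
# sibling step INSIDE the pinned region `3aq > 2`

builds on p205010 (kernel theorem, internal audit signed; external expert review pending)

Support file (`--supports stmt-CriticalPhenomena-4575`), QUANT lane lead seat prim-quant-lead (gen 44); memo
`run/shared/lean/prim/quant/prim-quant-lead-g44/LEAD-NOTES-G44.md` F9, README V417.  Theorems only, standard axioms, no sorries.  Template:
census-2 g71's `decAt_threeRoot_of_oracle` (`…QuantThreeRootGateStep`), which covers the complementary UNPINNED side.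

THE STEP (`decAt_tiedCore_of_oracle`): inside `GateStepN`'s binder, three sibling trees with a COMMON root gate `q`, opened laws
`ρᵢ = ρᵢ⁻ ∗ gate_s σᵢ` (root part `ρᵢ⁻` at floor `ym`, sub-forest `σᵢ` at floor `yσ`, COMMON top internal gate `s`), base floor `y ≤ ym`, `y ≤ s·yσ`,
outer gate `a`; with the per-tree version gates `τₖ`, `tₖ` of `tiedCore_gateCoupling_general` (pinned: `Dₖ > 0`; `τₖ ≤ 1`; version floors)
the law `gate_a(gate_q ρ₁ ∗ gate_q ρ₂ ∗ gate_q ρ₃)` is DEC(j) at floor `a·q·y` at EVERY layer: eight components at the common target `S` —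
block (oracle + `gate_m`), product (oracle pair + oracle single, `convClosedT_holds`), six versions (oracle) — and `decAtT_finite_mixture`.

HONEST STATUS.  A solved sub-case of `SiblingStep` (k = 3, common root gate, common top internal gate, pinned band); `SiblingStep`, `GateStepN`,
`FarTreeRow` remain OPEN; RATE class (log\*) and the honest sentence of `run/shared/lean/prim/quant/README.md` unchanged.  [this work]; template and
oracle lemmas: prim-quant-census-2 g71; `convClosedT_holds`: census-2 g60; `decAtT_all_of_below`, `decAtT_gate_of_sdec`: prim-quant-arm-1 g46.
Nothing here is a published result.  The gluing rows served [cite: KozmaNitzan2024, Conjecture 3 (p. 15)]; product measure [cite: Grimmett1999, §1.3 p. 10].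
(Typer g40 re-filing of lead g44's file of record after the content bounce of p398493; proof-script repairs only, statements unchanged.)
-/

noncomputable section

namespace Summit.CriticalPhenomena.PercolationContinuityZ3.Theorems

namespace Quant

namespace LawDec

/-- **an ungated tree-built law below the budget is DEC at every layer at the target equal to its mean, on any larger top and any lower
floor** (oracle + Theorem A; bookkeeping form of census-2's `decAtT_of_oracle` with the mean as a named real). [this work] -/
theorem decAtT_of_oracle_mean (n : ℕ)
    (hO : ∀ (x' : ℝ) (n' M' : ℕ) (μ' : ℕ → ℝ), n' < n → TreeBuiltN x' n' M' μ' → SDEC x' M' μ')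
    {z : ℝ} {n' N : ℕ} {ν : ℕ → ℝ} (hν : TreeBuiltN z n' N ν) (hn' : n' < n) {w : ℝ} (hwz : w ≤ z) (M : ℕ) (hNM : N ≤ M)
    {T : ℝ} (hT : ∑ h ∈ Finset.range (N + 1), (h : ℝ) * ν h = T) (j : ℕ) : DECAtT w T j M ν := by
  have d := decAtT_of_oracle n hO hν hn' hwz M hNM j
  rwa [hT] at d

/-- **THE TIED-CORE GATE STEP FROM THE ORACLE** (see the file header). [this work] -/
theorem decAt_tiedCore_of_oracle (n : ℕ) (y ym yσ q s a : ℝ) (nm₁ nm₂ nm₃ ns₁ ns₂ ns₃ Mm₁ Mm₂ Mm₃ Ms₁ Ms₂ Ms₃ : ℕ)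
    (ρ₁m ρ₂m ρ₃m σ₁ σ₂ σ₃ : ℕ → ℝ) (Rm₁ Rm₂ Rm₃ Rs₁ Rs₂ Rs₃ τ₁ τ₂ τ₃ t₁ t₂ t₃ : ℝ)
    (hO : ∀ (x' : ℝ) (n' M' : ℕ) (μ' : ℕ → ℝ), n' < n → TreeBuiltN x' n' M' μ' → SDEC x' M' μ')
    (hn : (nm₁ + ns₁ + 1) + (nm₂ + ns₂ + 1) + (nm₃ + ns₃ + 1) + 3 ≤ n)
    (hy0 : 0 < y) (hyym : y ≤ ym) (hyys : y ≤ s * yσ)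
    (hq0 : 0 < q) (hq1 : q < 1) (hs0 : 0 < s) (hs1 : s < 1) (ha0 : 0 < a) (ha1 : a ≤ 1)
    (hMm₁ : 0 < Mm₁) (hMm₂ : 0 < Mm₂) (hMm₃ : 0 < Mm₃)
    (hρ₁m : TreeBuiltN ym nm₁ Mm₁ ρ₁m) (hρ₂m : TreeBuiltN ym nm₂ Mm₂ ρ₂m) (hρ₃m : TreeBuiltN ym nm₃ Mm₃ ρ₃m)
    (hσ₁ : TreeBuiltN yσ ns₁ Ms₁ σ₁) (hσ₂ : TreeBuiltN yσ ns₂ Ms₂ σ₂) (hσ₃ : TreeBuiltN yσ ns₃ Ms₃ σ₃)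
    -- the means (named)
    (hRm₁ : ∑ h ∈ Finset.range (Mm₁ + 1), (h : ℝ) * ρ₁m h = Rm₁) (hRm₂ : ∑ h ∈ Finset.range (Mm₂ + 1), (h : ℝ) * ρ₂m h = Rm₂)
    (hRm₃ : ∑ h ∈ Finset.range (Mm₃ + 1), (h : ℝ) * ρ₃m h = Rm₃)
    (hRs₁ : ∑ h ∈ Finset.range (Ms₁ + 1), (h : ℝ) * σ₁ h = Rs₁) (hRs₂ : ∑ h ∈ Finset.range (Ms₂ + 1), (h : ℝ) * σ₂ h = Rs₂)
    (hRs₃ : ∑ h ∈ Finset.range (Ms₃ + 1), (h : ℝ) * σ₃ h = Rs₃)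
    -- the version gates from the means (`Dₖ = S − Rᵢ − Rⱼ`; pinned: `Dₖ > 0`), dropped gates `≤ 1`, version floors
    (hτ₁ : τ₁ * Rm₁ = a * q * ((Rm₁ + s * Rs₁) + (Rm₂ + s * Rs₂) + (Rm₃ + s * Rs₃)) - (Rm₂ + s * Rs₂) - (Rm₃ + s * Rs₃))
    (hτ₂ : τ₂ * Rm₂ = a * q * ((Rm₁ + s * Rs₁) + (Rm₂ + s * Rs₂) + (Rm₃ + s * Rs₃)) - (Rm₁ + s * Rs₁) - (Rm₃ + s * Rs₃))
    (hτ₃ : τ₃ * Rm₃ = a * q * ((Rm₁ + s * Rs₁) + (Rm₂ + s * Rs₂) + (Rm₃ + s * Rs₃)) - (Rm₁ + s * Rs₁) - (Rm₂ + s * Rs₂))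
    (ht₁ : t₁ * (Rm₁ + Rs₁) = τ₁ * Rm₁) (ht₂ : t₂ * (Rm₂ + Rs₂) = τ₂ * Rm₂) (ht₃ : t₃ * (Rm₃ + Rs₃) = τ₃ * Rm₃)
    (hD₁ : 0 < τ₁ * Rm₁) (hD₂ : 0 < τ₂ * Rm₂) (hD₃ : 0 < τ₃ * Rm₃)
    (hτ₁1 : τ₁ ≤ 1) (hτ₂1 : τ₂ ≤ 1) (hτ₃1 : τ₃ ≤ 1)
    (hfτ₁ : a * q * y ≤ τ₁ * ym) (hfτ₂ : a * q * y ≤ τ₂ * ym) (hfτ₃ : a * q * y ≤ τ₃ * ym)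
    (hft₁ : a * q * y ≤ t₁ * ym) (hft₂ : a * q * y ≤ t₂ * ym) (hft₃ : a * q * y ≤ t₃ * ym)
    (hfs₁ : a * q * y ≤ t₁ * yσ) (hfs₂ : a * q * y ≤ t₂ * yσ) (hfs₃ : a * q * y ≤ t₃ * yσ)
    (j : ℕ) :
    DECAt (a * q * y) j ((Mm₁ + Ms₁) + (Mm₂ + Ms₂) + (Mm₃ + Ms₃))
      (gate (lconv ((Mm₁ + Ms₁) + (Mm₂ + Ms₂)) (Mm₃ + Ms₃)
        (lconv (Mm₁ + Ms₁) (Mm₂ + Ms₂) (gate (lconv Mm₁ Ms₁ ρ₁m (gate σ₁ s)) q) (gate (lconv Mm₂ Ms₂ ρ₂m (gate σ₂ s)) q))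
        (gate (lconv Mm₃ Ms₃ ρ₃m (gate σ₃ s)) q)) a) := by
  -- elementary facts
  have hm0 : 0 < a * q := mul_pos ha0 hq0
  have hm1 : a * q < 1 := lt_of_le_of_lt (mul_le_of_le_one_left hq0.le ha1) hq1
  have hmne : 1 - a * q ≠ 0 := sub_ne_zero.2 (ne_of_gt hm1)
  have hym0 : 0 < ym := lt_of_lt_of_le hy0 hyym
  have hyσ0 : 0 < yσ := pos_of_mul_pos_right (lt_of_lt_of_le hy0 hyys) hs0.le
  have hw0 : 0 < a * q * y := mul_pos hm0 hy0
  have hwy : a * q * y ≤ y := mul_le_of_le_one_left hy0.le hm1.le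
  obtain ⟨_, _, r₁0, r₁M, r₁1, r₁ta⟩ := hρ₁m.lawFacts
  obtain ⟨_, _, r₂0, r₂M, r₂1, r₂ta⟩ := hρ₂m.lawFacts
  obtain ⟨_, _, r₃0, r₃M, r₃1, r₃ta⟩ := hρ₃m.lawFacts
  obtain ⟨_, _, s₁0, s₁M, s₁1, s₁ta⟩ := hσ₁.lawFacts
  obtain ⟨_, _, s₂0, s₂M, s₂1, s₂ta⟩ := hσ₂.lawFacts
  obtain ⟨_, _, s₃0, s₃M, s₃1, s₃ta⟩ := hσ₃.lawFacts
  have hRm₁0 : 0 < Rm₁ := by rw [← hRm₁]; exact lt_of_lt_of_le (mul_pos hym0 (by exact_mod_cast hMm₁)) r₁ta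
  have hRm₂0 : 0 < Rm₂ := by rw [← hRm₂]; exact lt_of_lt_of_le (mul_pos hym0 (by exact_mod_cast hMm₂)) r₂ta
  have hRm₃0 : 0 < Rm₃ := by rw [← hRm₃]; exact lt_of_lt_of_le (mul_pos hym0 (by exact_mod_cast hMm₃)) r₃ta
  have hRs₁0 : 0 ≤ Rs₁ := by rw [← hRs₁]; exact le_trans (mul_nonneg hyσ0.le (Nat.cast_nonneg _)) s₁ta
  have hRs₂0 : 0 ≤ Rs₂ := by rw [← hRs₂]; exact le_trans (mul_nonneg hyσ0.le (Nat.cast_nonneg _)) s₂ta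
  have hRs₃0 : 0 ≤ Rs₃ := by rw [← hRs₃]; exact le_trans (mul_nonneg hyσ0.le (Nat.cast_nonneg _)) s₃ta
  have hRp₁0 : 0 < Rm₁ + Rs₁ := by linarith
  have hRp₂0 : 0 < Rm₂ + Rs₂ := by linarith
  have hRp₃0 : 0 < Rm₃ + Rs₃ := by linarith
  have hR₁0 : 0 < Rm₁ + s * Rs₁ := by have e := mul_nonneg hs0.le hRs₁0; linarith
  have hR₂0 : 0 < Rm₂ + s * Rs₂ := by have e := mul_nonneg hs0.le hRs₂0; linarith
  have hR₃0 : 0 < Rm₃ + s * Rs₃ := by have e := mul_nonneg hs0.le hRs₃0; linarith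
  have hSig0 : 0 < ((Rm₁ + s * Rs₁) + (Rm₂ + s * Rs₂) + (Rm₃ + s * Rs₃)) := by linarith
  -- the version gates are positive, `t ≤ 1`
  have hD₁' : 0 < τ₁ * Rm₁ := hD₁
  have hD₂' : 0 < τ₂ * Rm₂ := hD₂
  have hD₃' : 0 < τ₃ * Rm₃ := hD₃
  have hτ₁0 : 0 < τ₁ := pos_of_mul_pos_left hD₁' hRm₁0.le
  have hτ₂0 : 0 < τ₂ := pos_of_mul_pos_left hD₂' hRm₂0.le
  have hτ₃0 : 0 < τ₃ := pos_of_mul_pos_left hD₃' hRm₃0.le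
  have ht₁0 : 0 < t₁ := pos_of_mul_pos_left (by rw [ht₁]; exact hD₁') hRp₁0.le
  have ht₂0 : 0 < t₂ := pos_of_mul_pos_left (by rw [ht₂]; exact hD₂') hRp₂0.le
  have ht₃0 : 0 < t₃ := pos_of_mul_pos_left (by rw [ht₃]; exact hD₃') hRp₃0.le
  have ht₁1 : t₁ ≤ 1 := by
    by_contra hc
    rw [not_le] at hc
    have h1 : 1 * (Rm₁ + Rs₁) < t₁ * (Rm₁ + Rs₁) := mul_lt_mul_of_pos_right hc hRp₁0
    have h2 : τ₁ * Rm₁ ≤ 1 * Rm₁ := mul_le_mul_of_nonneg_right hτ₁1 hRm₁0.le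
    rw [ht₁] at h1
    linarith
  have ht₂1 : t₂ ≤ 1 := by
    by_contra hc
    rw [not_le] at hc
    have h1 : 1 * (Rm₂ + Rs₂) < t₂ * (Rm₂ + Rs₂) := mul_lt_mul_of_pos_right hc hRp₂0
    have h2 : τ₂ * Rm₂ ≤ 1 * Rm₂ := mul_le_mul_of_nonneg_right hτ₂1 hRm₂0.le
    rw [ht₂] at h1
    linarith
  have ht₃1 : t₃ ≤ 1 := by
    by_contra hc
    rw [not_le] at hc
    have h1 : 1 * (Rm₃ + Rs₃) < t₃ * (Rm₃ + Rs₃) := mul_lt_mul_of_pos_right hc hRp₃0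
    have h2 : τ₃ * Rm₃ ≤ 1 * Rm₃ := mul_le_mul_of_nonneg_right hτ₃1 hRm₃0.le
    rw [ht₃] at h1
    linarith
  -- the opened trees `ρᵢ = ρᵢm ∗ gate_s σᵢ` at floor `y`
  have hρ₁ : TreeBuiltN y (nm₁ + (ns₁ + 1)) (Mm₁ + Ms₁) (lconv Mm₁ Ms₁ ρ₁m (gate σ₁ s)) :=
    TreeBuiltN.conv (TreeBuiltN.mono hρ₁m hy0 hyym) (TreeBuiltN.mono (TreeBuiltN.gate s hs0 hs1 hσ₁) hy0 hyys)
  have hρ₂ : TreeBuiltN y (nm₂ + (ns₂ + 1)) (Mm₂ + Ms₂) (lconv Mm₂ Ms₂ ρ₂m (gate σ₂ s)) :=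
    TreeBuiltN.conv (TreeBuiltN.mono hρ₂m hy0 hyym) (TreeBuiltN.mono (TreeBuiltN.gate s hs0 hs1 hσ₂) hy0 hyys)
  have hρ₃ : TreeBuiltN y (nm₃ + (ns₃ + 1)) (Mm₃ + Ms₃) (lconv Mm₃ Ms₃ ρ₃m (gate σ₃ s)) :=
    TreeBuiltN.conv (TreeBuiltN.mono hρ₃m hy0 hyym) (TreeBuiltN.mono (TreeBuiltN.gate s hs0 hs1 hσ₃) hy0 hyys)
  set ρ₁ : ℕ → ℝ := lconv Mm₁ Ms₁ ρ₁m (gate σ₁ s) with hρ₁def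
  set ρ₂ : ℕ → ℝ := lconv Mm₂ Ms₂ ρ₂m (gate σ₂ s) with hρ₂def
  set ρ₃ : ℕ → ℝ := lconv Mm₃ Ms₃ ρ₃m (gate σ₃ s) with hρ₃def
  obtain ⟨_, _, p₁0, p₁M, p₁1, _⟩ := hρ₁.lawFacts
  obtain ⟨_, _, p₂0, p₂M, p₂1, _⟩ := hρ₂.lawFacts
  obtain ⟨_, _, p₃0, p₃M, p₃1, _⟩ := hρ₃.lawFacts
  obtain ⟨_, _, gs₁1⟩ := gate_laws Ms₁ σ₁ s hs0.le hs1.le s₁0 s₁M s₁1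
  obtain ⟨_, _, gs₂1⟩ := gate_laws Ms₂ σ₂ s hs0.le hs1.le s₂0 s₂M s₂1
  obtain ⟨_, _, gs₃1⟩ := gate_laws Ms₃ σ₃ s hs0.le hs1.le s₃0 s₃M s₃1
  have hmean₁ : ∑ h ∈ Finset.range (Mm₁ + Ms₁ + 1), (h : ℝ) * ρ₁ h = Rm₁ + s * Rs₁ := by
    rw [hρ₁def, sum_mul_lconv Mm₁ Ms₁ _ _ r₁1 gs₁1, sum_mul_gate, hRm₁, hRs₁]
  have hmean₂ : ∑ h ∈ Finset.range (Mm₂ + Ms₂ + 1), (h : ℝ) * ρ₂ h = Rm₂ + s * Rs₂ := by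
    rw [hρ₂def, sum_mul_lconv Mm₂ Ms₂ _ _ r₂1 gs₂1, sum_mul_gate, hRm₂, hRs₂]
  have hmean₃ : ∑ h ∈ Finset.range (Mm₃ + Ms₃ + 1), (h : ℝ) * ρ₃ h = Rm₃ + s * Rs₃ := by
    rw [hρ₃def, sum_mul_lconv Mm₃ Ms₃ _ _ r₃1 gs₃1, sum_mul_gate, hRm₃, hRs₃]
  -- attached versions `νᵢ = ρᵢm ∗ σᵢ` at floor `min ym yσ`
  have hv0 : 0 < min ym yσ := lt_min hym0 hyσ0
  have hν₁ : TreeBuiltN (min ym yσ) (nm₁ + ns₁) (Mm₁ + Ms₁) (lconv Mm₁ Ms₁ ρ₁m σ₁) :=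
    TreeBuiltN.conv (TreeBuiltN.mono hρ₁m hv0 (min_le_left _ _)) (TreeBuiltN.mono hσ₁ hv0 (min_le_right _ _))
  have hν₂ : TreeBuiltN (min ym yσ) (nm₂ + ns₂) (Mm₂ + Ms₂) (lconv Mm₂ Ms₂ ρ₂m σ₂) :=
    TreeBuiltN.conv (TreeBuiltN.mono hρ₂m hv0 (min_le_left _ _)) (TreeBuiltN.mono hσ₂ hv0 (min_le_right _ _))
  have hν₃ : TreeBuiltN (min ym yσ) (nm₃ + ns₃) (Mm₃ + Ms₃) (lconv Mm₃ Ms₃ ρ₃m σ₃) :=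
    TreeBuiltN.conv (TreeBuiltN.mono hρ₃m hv0 (min_le_left _ _)) (TreeBuiltN.mono hσ₃ hv0 (min_le_right _ _))
  set ν₁ : ℕ → ℝ := lconv Mm₁ Ms₁ ρ₁m σ₁ with hν₁def
  set ν₂ : ℕ → ℝ := lconv Mm₂ Ms₂ ρ₂m σ₂ with hν₂def
  set ν₃ : ℕ → ℝ := lconv Mm₃ Ms₃ ρ₃m σ₃ with hν₃def
  obtain ⟨_, _, v₁0, v₁M, v₁1, _⟩ := hν₁.lawFacts
  obtain ⟨_, _, v₂0, v₂M, v₂1, _⟩ := hν₂.lawFacts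
  obtain ⟨_, _, v₃0, v₃M, v₃1, _⟩ := hν₃.lawFacts
  have hmp₁ : ∑ h ∈ Finset.range (Mm₁ + Ms₁ + 1), (h : ℝ) * ν₁ h = Rm₁ + Rs₁ := by rw [hν₁def, sum_mul_lconv Mm₁ Ms₁ _ _ r₁1 s₁1, hRm₁, hRs₁]
  have hmp₂ : ∑ h ∈ Finset.range (Mm₂ + Ms₂ + 1), (h : ℝ) * ν₂ h = Rm₂ + Rs₂ := by rw [hν₂def, sum_mul_lconv Mm₂ Ms₂ _ _ r₂1 s₂1, hRm₂, hRs₂]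
  have hmp₃ : ∑ h ∈ Finset.range (Mm₃ + Ms₃ + 1), (h : ℝ) * ν₃ h = Rm₃ + Rs₃ := by rw [hν₃def, sum_mul_lconv Mm₃ Ms₃ _ _ r₃1 s₃1, hRm₃, hRs₃]
  -- the splits `ρᵢ = (1−s)·ρᵢm + s·νᵢ`
  have hsp₁ : ρ₁ = fun k => (1 - s) * ρ₁m k + s * ν₁ k := by
    funext k; rw [hρ₁def, hν₁def, lconv_gate_right Mm₁ Ms₁ ρ₁m σ₁ s r₁M k]; ring
  have hsp₂ : ρ₂ = fun k => (1 - s) * ρ₂m k + s * ν₂ k := by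
    funext k; rw [hρ₂def, hν₂def, lconv_gate_right Mm₂ Ms₂ ρ₂m σ₂ s r₂M k]; ring
  have hsp₃ : ρ₃ = fun k => (1 - s) * ρ₃m k + s * ν₃ k := by
    funext k; rw [hρ₃def, hν₃def, lconv_gate_right Mm₃ Ms₃ ρ₃m σ₃ s r₃M k]; ring
  -- the floor `a·q·y` lies below every component floor
  have hwt₁ : a * q * y ≤ t₁ * min ym yσ := by rw [mul_min_of_nonneg _ _ ht₁0.le]; exact le_min hft₁ hfs₁
  have hwt₂ : a * q * y ≤ t₂ * min ym yσ := by rw [mul_min_of_nonneg _ _ ht₂0.le]; exact le_min hft₂ hfs₂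
  have hwt₃ : a * q * y ≤ t₃ * min ym yσ := by rw [mul_min_of_nonneg _ _ ht₃0.le]; exact le_min hft₃ hfs₃
  -- the pair and the triple of opened trees at the floor `a·q·y`
  have hρ₁w := TreeBuiltN.mono hρ₁ hw0 hwy
  have hρ₂w := TreeBuiltN.mono hρ₂ hw0 hwy
  have hρ₃w := TreeBuiltN.mono hρ₃ hw0 hwy
  have t₁₂ := TreeBuiltN.conv hρ₁ hρ₂
  have t₁₂w := TreeBuiltN.conv hρ₁w hρ₂w
  obtain ⟨_, _, l₁₂0, l₁₂M, l₁₂1, _⟩ := t₁₂.lawFacts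
  -- (N) the natural block
  obtain ⟨nB, hnB, hB⟩ := exists_gate_of_treeBuiltN (TreeBuiltN.conv t₁₂ hρ₃) (a * q) hm0 hm1.le
  have dN : DECAtT (a * q * y) (a * q * ((Rm₁ + s * Rs₁) + (Rm₂ + s * Rs₂) + (Rm₃ + s * Rs₃))) j ((Mm₁ + Ms₁) + (Mm₂ + Ms₂) + (Mm₃ + Ms₃))
      (gate (lconv ((Mm₁ + Ms₁) + (Mm₂ + Ms₂)) (Mm₃ + Ms₃) (lconv (Mm₁ + Ms₁) (Mm₂ + Ms₂) ρ₁ ρ₂) ρ₃) (a * q)) := by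
    refine decAtT_of_oracle_mean n hO hB (by omega) le_rfl _ le_rfl ?_ j
    rw [sum_mul_gate, sum_mul_lconv _ _ _ _ l₁₂1 p₃1, sum_mul_lconv _ _ _ _ p₁1 p₂1, hmean₁, hmean₂, hmean₃]
  -- (P) the natural product: the pair of gated trees and the third gated tree are oracle instances; ConvClosedT
  obtain ⟨nc₁, hnc₁, hc₁⟩ := exists_gate_of_treeBuiltN hρ₁ (a * q) hm0 hm1.le
  obtain ⟨nc₂, hnc₂, hc₂⟩ := exists_gate_of_treeBuiltN hρ₂ (a * q) hm0 hm1.le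
  obtain ⟨nc₃, hnc₃, hc₃⟩ := exists_gate_of_treeBuiltN hρ₃ (a * q) hm0 hm1.le
  obtain ⟨g₁0, g₁M, g₁1⟩ := gate_laws (Mm₁ + Ms₁) ρ₁ (a * q) hm0.le hm1.le p₁0 p₁M p₁1
  obtain ⟨g₂0, g₂M, g₂1⟩ := gate_laws (Mm₂ + Ms₂) ρ₂ (a * q) hm0.le hm1.le p₂0 p₂M p₂1
  obtain ⟨g₃0, g₃M, g₃1⟩ := gate_laws (Mm₃ + Ms₃) ρ₃ (a * q) hm0.le hm1.le p₃0 p₃M p₃1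
  have hpair := TreeBuiltN.conv hc₁ hc₂
  obtain ⟨_, _, q₁₂0, q₁₂M, q₁₂1, _⟩ := hpair.lawFacts
  have dpair : ∀ j'', DECAtT (a * q * y) (a * q * (Rm₁ + s * Rs₁) + a * q * (Rm₂ + s * Rs₂)) j'' ((Mm₁ + Ms₁) + (Mm₂ + Ms₂))
      (lconv (Mm₁ + Ms₁) (Mm₂ + Ms₂) (gate ρ₁ (a * q)) (gate ρ₂ (a * q))) := by
    intro j''
    refine decAtT_of_oracle_mean n hO hpair (by omega) le_rfl _ le_rfl ?_ j''
    rw [sum_mul_lconv _ _ _ _ g₁1 g₂1, sum_mul_gate, sum_mul_gate, hmean₁, hmean₂]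
  have d₃ : ∀ j'', DECAtT (a * q * y) (a * q * (Rm₃ + s * Rs₃)) j'' (Mm₃ + Ms₃) (gate ρ₃ (a * q)) := by
    intro j''
    refine decAtT_of_oracle_mean n hO hc₃ (by omega) le_rfl _ le_rfl ?_ j''
    rw [sum_mul_gate, hmean₃]
  have hPtop := TreeBuiltN.conv hpair hc₃
  obtain ⟨_, hw1, P0, PM, P1, Pta⟩ := hPtop.lawFacts
  have hPmean : ∑ h ∈ Finset.range (((Mm₁ + Ms₁) + (Mm₂ + Ms₂) + (Mm₃ + Ms₃)) + 1),
      (h : ℝ) * lconv ((Mm₁ + Ms₁) + (Mm₂ + Ms₂)) (Mm₃ + Ms₃) (lconv (Mm₁ + Ms₁) (Mm₂ + Ms₂) (gate ρ₁ (a * q)) (gate ρ₂ (a * q)))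
        (gate ρ₃ (a * q)) h = (a * q * ((Rm₁ + s * Rs₁) + (Rm₂ + s * Rs₂) + (Rm₃ + s * Rs₃))) := by
    rw [sum_mul_lconv _ _ _ _ q₁₂1 g₃1, sum_mul_lconv _ _ _ _ g₁1 g₂1, sum_mul_gate, sum_mul_gate, sum_mul_gate, hmean₁, hmean₂, hmean₃]
    ring
  have dP : DECAtT (a * q * y) (a * q * ((Rm₁ + s * Rs₁) + (Rm₂ + s * Rs₂) + (Rm₃ + s * Rs₃))) j ((Mm₁ + Ms₁) + (Mm₂ + Ms₂) + (Mm₃ + Ms₃))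
      (lconv ((Mm₁ + Ms₁) + (Mm₂ + Ms₂)) (Mm₃ + Ms₃) (lconv (Mm₁ + Ms₁) (Mm₂ + Ms₂) (gate ρ₁ (a * q)) (gate ρ₂ (a * q))) (gate ρ₃ (a * q))) := by
    have below : ∀ j'', j'' < ((Mm₁ + Ms₁) + (Mm₂ + Ms₂) + (Mm₃ + Ms₃)) → DECAtT (a * q * y) (a * q * ((Rm₁ + s * Rs₁) + (Rm₂ + s * Rs₂) + (Rm₃ + s * Rs₃))) j'' ((Mm₁ + Ms₁) + (Mm₂ + Ms₂) + (Mm₃ + Ms₃))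
        (lconv ((Mm₁ + Ms₁) + (Mm₂ + Ms₂)) (Mm₃ + Ms₃) (lconv (Mm₁ + Ms₁) (Mm₂ + Ms₂) (gate ρ₁ (a * q)) (gate ρ₂ (a * q)))
          (gate ρ₃ (a * q))) := by
      intro j'' hj''
      have hC := convClosedT_holds (a * q * y) (a * q * (Rm₁ + s * Rs₁) + a * q * (Rm₂ + s * Rs₂)) (a * q * (Rm₃ + s * Rs₃))
        ((Mm₁ + Ms₁) + (Mm₂ + Ms₂)) (Mm₃ + Ms₃) j'' _ _ hw0 hw1 q₁₂0 q₁₂M q₁₂1 g₃0 g₃M g₃1 hj''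
        (fun k _ _ => dpair k) (fun k _ _ => d₃ k)
      have e : a * q * (Rm₁ + s * Rs₁) + a * q * (Rm₂ + s * Rs₂) + a * q * (Rm₃ + s * Rs₃) = (a * q * ((Rm₁ + s * Rs₁) + (Rm₂ + s * Rs₂) + (Rm₃ + s * Rs₃))) := by ring
      rwa [e] at hC
    have key := decAtT_all_of_below _ _ (a * q * y) hw0.le hw1 P0 PM P1 Pta (by rw [hPmean]; exact below) j
    rwa [hPmean] at key
  -- (U) dropped versions `ρᵢ ∗ ρⱼ ∗ gate_τ ρₖm`
  obtain ⟨nu₁, hnu₁, hu₁⟩ := exists_gate_of_treeBuiltN hρ₁m τ₁ hτ₁0 hτ₁1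
  obtain ⟨nu₂, hnu₂, hu₂⟩ := exists_gate_of_treeBuiltN hρ₂m τ₂ hτ₂0 hτ₂1
  obtain ⟨nu₃, hnu₃, hu₃⟩ := exists_gate_of_treeBuiltN hρ₃m τ₃ hτ₃0 hτ₃1
  obtain ⟨_, u₁M, u₁1⟩ := gate_laws Mm₁ ρ₁m τ₁ hτ₁0.le hτ₁1 r₁0 r₁M r₁1
  obtain ⟨_, u₂M, u₂1⟩ := gate_laws Mm₂ ρ₂m τ₂ hτ₂0.le hτ₂1 r₂0 r₂M r₂1
  obtain ⟨_, u₃M, u₃1⟩ := gate_laws Mm₃ ρ₃m τ₃ hτ₃0.le hτ₃1 r₃0 r₃M r₃1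
  have hu₁w := TreeBuiltN.mono hu₁ hw0 hfτ₁
  have hu₂w := TreeBuiltN.mono hu₂ hw0 hfτ₂
  have hu₃w := TreeBuiltN.mono hu₃ hw0 hfτ₃
  have dU₃ : DECAtT (a * q * y) (a * q * ((Rm₁ + s * Rs₁) + (Rm₂ + s * Rs₂) + (Rm₃ + s * Rs₃))) j ((Mm₁ + Ms₁) + (Mm₂ + Ms₂) + (Mm₃ + Ms₃))
      (lconv ((Mm₁ + Ms₁) + (Mm₂ + Ms₂)) (Mm₃ + Ms₃) (lconv (Mm₁ + Ms₁) (Mm₂ + Ms₂) ρ₁ ρ₂) (gate ρ₃m τ₃)) := by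
    have d := decAtT_of_oracle_mean n hO (TreeBuiltN.conv t₁₂w hu₃w) (by omega) le_rfl ((Mm₁ + Ms₁) + (Mm₂ + Ms₂) + (Mm₃ + Ms₃)) (by omega) (T := a * q * ((Rm₁ + s * Rs₁) + (Rm₂ + s * Rs₂) + (Rm₃ + s * Rs₃))) ?_ j
    · have e : lconv ((Mm₁ + Ms₁) + (Mm₂ + Ms₂)) (Mm₃ + Ms₃) (lconv (Mm₁ + Ms₁) (Mm₂ + Ms₂) ρ₁ ρ₂) (gate ρ₃m τ₃)
          = lconv ((Mm₁ + Ms₁) + (Mm₂ + Ms₂)) Mm₃ (lconv (Mm₁ + Ms₁) (Mm₂ + Ms₂) ρ₁ ρ₂) (gate ρ₃m τ₃) :=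
        funext fun h => lconv_top_right_of_le _ _ _ _ _ (by omega) u₃M h
      rw [e]; exact d
    · rw [sum_mul_lconv _ _ _ _ l₁₂1 u₃1, sum_mul_lconv _ _ _ _ p₁1 p₂1, sum_mul_gate, hmean₁, hmean₂, hRm₃]
      linear_combination hτ₃
  have dU₁ : DECAtT (a * q * y) (a * q * ((Rm₁ + s * Rs₁) + (Rm₂ + s * Rs₂) + (Rm₃ + s * Rs₃))) j ((Mm₁ + Ms₁) + (Mm₂ + Ms₂) + (Mm₃ + Ms₃))
      (lconv ((Mm₁ + Ms₁) + (Mm₂ + Ms₂)) (Mm₃ + Ms₃) (lconv (Mm₁ + Ms₁) (Mm₂ + Ms₂) (gate ρ₁m τ₁) ρ₂) ρ₃) := by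
    have T := TreeBuiltN.conv (TreeBuiltN.conv hu₁w hρ₂w) hρ₃w
    obtain ⟨_, _, _, i₁₂M, i₁₂1, _⟩ := (TreeBuiltN.conv hu₁w hρ₂w).lawFacts
    have d := decAtT_of_oracle_mean n hO T (by omega) le_rfl ((Mm₁ + Ms₁) + (Mm₂ + Ms₂) + (Mm₃ + Ms₃)) (by omega) (T := a * q * ((Rm₁ + s * Rs₁) + (Rm₂ + s * Rs₂) + (Rm₃ + s * Rs₃))) ?_ j
    · have ein : lconv (Mm₁ + Ms₁) (Mm₂ + Ms₂) (gate ρ₁m τ₁) ρ₂ = lconv Mm₁ (Mm₂ + Ms₂) (gate ρ₁m τ₁) ρ₂ :=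
        funext fun h => lconv_top_left_of_le _ _ _ _ _ (by omega) u₁M h
      have e : lconv ((Mm₁ + Ms₁) + (Mm₂ + Ms₂)) (Mm₃ + Ms₃) (lconv (Mm₁ + Ms₁) (Mm₂ + Ms₂) (gate ρ₁m τ₁) ρ₂) ρ₃
          = lconv (Mm₁ + (Mm₂ + Ms₂)) (Mm₃ + Ms₃) (lconv Mm₁ (Mm₂ + Ms₂) (gate ρ₁m τ₁) ρ₂) ρ₃ := by
        rw [ein]; exact funext fun h => lconv_top_left_of_le _ _ _ _ _ (by omega) i₁₂M h
      rw [e]; exact d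
    · rw [sum_mul_lconv _ _ _ _ i₁₂1 p₃1, sum_mul_lconv _ _ _ _ u₁1 p₂1, sum_mul_gate, hmean₂, hmean₃, hRm₁]
      linear_combination hτ₁
  have dU₂ : DECAtT (a * q * y) (a * q * ((Rm₁ + s * Rs₁) + (Rm₂ + s * Rs₂) + (Rm₃ + s * Rs₃))) j ((Mm₁ + Ms₁) + (Mm₂ + Ms₂) + (Mm₃ + Ms₃))
      (lconv ((Mm₁ + Ms₁) + (Mm₂ + Ms₂)) (Mm₃ + Ms₃) (lconv (Mm₁ + Ms₁) (Mm₂ + Ms₂) ρ₁ (gate ρ₂m τ₂)) ρ₃) := by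
    have T := TreeBuiltN.conv (TreeBuiltN.conv hρ₁w hu₂w) hρ₃w
    obtain ⟨_, _, _, i₁₂M, i₁₂1, _⟩ := (TreeBuiltN.conv hρ₁w hu₂w).lawFacts
    have d := decAtT_of_oracle_mean n hO T (by omega) le_rfl ((Mm₁ + Ms₁) + (Mm₂ + Ms₂) + (Mm₃ + Ms₃)) (by omega) (T := a * q * ((Rm₁ + s * Rs₁) + (Rm₂ + s * Rs₂) + (Rm₃ + s * Rs₃))) ?_ j
    · have ein : lconv (Mm₁ + Ms₁) (Mm₂ + Ms₂) ρ₁ (gate ρ₂m τ₂) = lconv (Mm₁ + Ms₁) Mm₂ ρ₁ (gate ρ₂m τ₂) :=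
        funext fun h => lconv_top_right_of_le _ _ _ _ _ (by omega) u₂M h
      have e : lconv ((Mm₁ + Ms₁) + (Mm₂ + Ms₂)) (Mm₃ + Ms₃) (lconv (Mm₁ + Ms₁) (Mm₂ + Ms₂) ρ₁ (gate ρ₂m τ₂)) ρ₃
          = lconv ((Mm₁ + Ms₁) + Mm₂) (Mm₃ + Ms₃) (lconv (Mm₁ + Ms₁) Mm₂ ρ₁ (gate ρ₂m τ₂)) ρ₃ := by
        rw [ein]; exact funext fun h => lconv_top_left_of_le _ _ _ _ _ (by omega) i₁₂M h
      rw [e]; exact d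
    · rw [sum_mul_lconv _ _ _ _ i₁₂1 p₃1, sum_mul_lconv _ _ _ _ p₁1 u₂1, sum_mul_gate, hmean₁, hmean₃, hRm₂]
      linear_combination hτ₂
  -- (D) attached versions `ρᵢ ∗ ρⱼ ∗ gate_t νₖ`
  obtain ⟨nd₁, hnd₁, hd₁⟩ := exists_gate_of_treeBuiltN hν₁ t₁ ht₁0 ht₁1
  obtain ⟨nd₂, hnd₂, hd₂⟩ := exists_gate_of_treeBuiltN hν₂ t₂ ht₂0 ht₂1
  obtain ⟨nd₃, hnd₃, hd₃⟩ := exists_gate_of_treeBuiltN hν₃ t₃ ht₃0 ht₃1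
  obtain ⟨_, _, e₁1⟩ := gate_laws (Mm₁ + Ms₁) ν₁ t₁ ht₁0.le ht₁1 v₁0 v₁M v₁1
  obtain ⟨_, _, e₂1⟩ := gate_laws (Mm₂ + Ms₂) ν₂ t₂ ht₂0.le ht₂1 v₂0 v₂M v₂1
  obtain ⟨_, _, e₃1⟩ := gate_laws (Mm₃ + Ms₃) ν₃ t₃ ht₃0.le ht₃1 v₃0 v₃M v₃1
  have hd₁w := TreeBuiltN.mono hd₁ hw0 hwt₁
  have hd₂w := TreeBuiltN.mono hd₂ hw0 hwt₂
  have hd₃w := TreeBuiltN.mono hd₃ hw0 hwt₃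
  have dD₃ : DECAtT (a * q * y) (a * q * ((Rm₁ + s * Rs₁) + (Rm₂ + s * Rs₂) + (Rm₃ + s * Rs₃))) j ((Mm₁ + Ms₁) + (Mm₂ + Ms₂) + (Mm₃ + Ms₃))
      (lconv ((Mm₁ + Ms₁) + (Mm₂ + Ms₂)) (Mm₃ + Ms₃) (lconv (Mm₁ + Ms₁) (Mm₂ + Ms₂) ρ₁ ρ₂) (gate ν₃ t₃)) := by
    refine decAtT_of_oracle_mean n hO (TreeBuiltN.conv t₁₂w hd₃w) (by omega) le_rfl ((Mm₁ + Ms₁) + (Mm₂ + Ms₂) + (Mm₃ + Ms₃)) le_rfl ?_ j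
    rw [sum_mul_lconv _ _ _ _ l₁₂1 e₃1, sum_mul_lconv _ _ _ _ p₁1 p₂1, sum_mul_gate, hmean₁, hmean₂, hmp₃]
    linear_combination ht₃ + hτ₃
  have dD₁ : DECAtT (a * q * y) (a * q * ((Rm₁ + s * Rs₁) + (Rm₂ + s * Rs₂) + (Rm₃ + s * Rs₃))) j ((Mm₁ + Ms₁) + (Mm₂ + Ms₂) + (Mm₃ + Ms₃))
      (lconv ((Mm₁ + Ms₁) + (Mm₂ + Ms₂)) (Mm₃ + Ms₃) (lconv (Mm₁ + Ms₁) (Mm₂ + Ms₂) (gate ν₁ t₁) ρ₂) ρ₃) := by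
    obtain ⟨_, _, _, _, i₁₂1, _⟩ := (TreeBuiltN.conv hd₁w hρ₂w).lawFacts
    refine decAtT_of_oracle_mean n hO (TreeBuiltN.conv (TreeBuiltN.conv hd₁w hρ₂w) hρ₃w) (by omega) le_rfl ((Mm₁ + Ms₁) + (Mm₂ + Ms₂) + (Mm₃ + Ms₃)) le_rfl ?_ j
    rw [sum_mul_lconv _ _ _ _ i₁₂1 p₃1, sum_mul_lconv _ _ _ _ e₁1 p₂1, sum_mul_gate, hmp₁, hmean₂, hmean₃]
    linear_combination ht₁ + hτ₁
  have dD₂ : DECAtT (a * q * y) (a * q * ((Rm₁ + s * Rs₁) + (Rm₂ + s * Rs₂) + (Rm₃ + s * Rs₃))) j ((Mm₁ + Ms₁) + (Mm₂ + Ms₂) + (Mm₃ + Ms₃))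
      (lconv ((Mm₁ + Ms₁) + (Mm₂ + Ms₂)) (Mm₃ + Ms₃) (lconv (Mm₁ + Ms₁) (Mm₂ + Ms₂) ρ₁ (gate ν₂ t₂)) ρ₃) := by
    obtain ⟨_, _, _, _, i₁₂1, _⟩ := (TreeBuiltN.conv hρ₁w hd₂w).lawFacts
    refine decAtT_of_oracle_mean n hO (TreeBuiltN.conv (TreeBuiltN.conv hρ₁w hd₂w) hρ₃w) (by omega) le_rfl ((Mm₁ + Ms₁) + (Mm₂ + Ms₂) + (Mm₃ + Ms₃)) le_rfl ?_ j
    rw [sum_mul_lconv _ _ _ _ i₁₂1 p₃1, sum_mul_lconv _ _ _ _ p₁1 e₂1, sum_mul_gate, hmean₁, hmp₂, hmean₃]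
    linear_combination ht₂ + hτ₂
  -- the weights
  set wN : ℝ := (1 - a) * q * (2 - q) / (1 - a * q) with hwN
  set wP : ℝ := ((1 - q) / (1 - a * q)) ^ 2 with hwP
  set cU : ℝ := (1 - s) * (1 - q) * (1 - a) * (a * q * q) / ((1 - a * q) ^ 2 * ((Rm₁ + s * Rs₁) + (Rm₂ + s * Rs₂) + (Rm₃ + s * Rs₃))) with hcU
  set cD : ℝ := (s * (1 - q) * (1 - a) * (a * q * q)) / ((1 - a * q) ^ 2 * ((Rm₁ + s * Rs₁) + (Rm₂ + s * Rs₂) + (Rm₃ + s * Rs₃))) with hcD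
  have h1m : 0 < 1 - a * q := sub_pos.2 hm1
  have h1q : 0 ≤ 1 - q := sub_nonneg.2 hq1.le
  have h1a : 0 ≤ 1 - a := sub_nonneg.2 ha1
  have h1s : 0 ≤ 1 - s := sub_nonneg.2 hs1.le
  have h2q : 0 ≤ 2 - q := by linarith
  have haqq : 0 ≤ a * q * q := mul_nonneg (mul_nonneg ha0.le hq0.le) hq0.le
  have hden : 0 ≤ (1 - a * q) ^ 2 * ((Rm₁ + s * Rs₁) + (Rm₂ + s * Rs₂) + (Rm₃ + s * Rs₃)) := mul_nonneg (sq_nonneg _) hSig0.le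
  have hwN0 : 0 ≤ wN := by rw [hwN]; exact div_nonneg (mul_nonneg (mul_nonneg h1a hq0.le) h2q) h1m.le
  have hwP0 : 0 ≤ wP := by rw [hwP]; exact sq_nonneg _
  have hcU0 : 0 ≤ cU := by rw [hcU]; exact div_nonneg (mul_nonneg (mul_nonneg (mul_nonneg h1s h1q) h1a) haqq) hden
  have hcD0 : 0 ≤ cD := by rw [hcD]; exact div_nonneg (mul_nonneg (mul_nonneg (mul_nonneg hs0.le h1q) h1a) haqq) hden
  have hsum : wN + wP + cU * (Rm₁ + Rm₂ + Rm₃) + cD * ((Rm₁ + Rs₁) + (Rm₂ + Rs₂) + (Rm₃ + Rs₃)) = 1 := by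
    rw [hwN, hwP, hcU, hcD]
    exact tiedCore_general_weights_sum q s a Rm₁ Rm₂ Rm₃ Rs₁ Rs₂ Rs₃ hmne hSig0.ne'
  -- the version gates in the form used by the identity
  have gτ₁ : ((a * q * ((Rm₁ + s * Rs₁) + (Rm₂ + s * Rs₂) + (Rm₃ + s * Rs₃))) - (Rm₂ + s * Rs₂) - (Rm₃ + s * Rs₃)) / Rm₁ = τ₁ := by
    rw [div_eq_iff hRm₁0.ne']; linear_combination hτ₁.symm
  have gτ₂ : ((a * q * ((Rm₁ + s * Rs₁) + (Rm₂ + s * Rs₂) + (Rm₃ + s * Rs₃))) - (Rm₁ + s * Rs₁) - (Rm₃ + s * Rs₃)) / Rm₂ = τ₂ := by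
    rw [div_eq_iff hRm₂0.ne']; linear_combination hτ₂.symm
  have gτ₃ : ((a * q * ((Rm₁ + s * Rs₁) + (Rm₂ + s * Rs₂) + (Rm₃ + s * Rs₃))) - (Rm₁ + s * Rs₁) - (Rm₂ + s * Rs₂)) / Rm₃ = τ₃ := by
    rw [div_eq_iff hRm₃0.ne']; linear_combination hτ₃.symm
  have gt₁ : ((a * q * ((Rm₁ + s * Rs₁) + (Rm₂ + s * Rs₂) + (Rm₃ + s * Rs₃))) - (Rm₂ + s * Rs₂) - (Rm₃ + s * Rs₃)) / (Rm₁ + Rs₁) = t₁ := by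
    rw [div_eq_iff hRp₁0.ne']; linear_combination hτ₁.symm + ht₁.symm
  have gt₂ : ((a * q * ((Rm₁ + s * Rs₁) + (Rm₂ + s * Rs₂) + (Rm₃ + s * Rs₃))) - (Rm₁ + s * Rs₁) - (Rm₃ + s * Rs₃)) / (Rm₂ + Rs₂) = t₂ := by
    rw [div_eq_iff hRp₂0.ne']; linear_combination hτ₂.symm + ht₂.symm
  have gt₃ : ((a * q * ((Rm₁ + s * Rs₁) + (Rm₂ + s * Rs₂) + (Rm₃ + s * Rs₃))) - (Rm₁ + s * Rs₁) - (Rm₂ + s * Rs₂)) / (Rm₃ + Rs₃) = t₃ := by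
    rw [div_eq_iff hRp₃0.ne']; linear_combination hτ₃.symm + ht₃.symm
  -- the eight-component mixture
  let W : Fin 8 → ℝ := ![wN, wP, cU * Rm₁, cU * Rm₂, cU * Rm₃, cD * (Rm₁ + Rs₁), cD * (Rm₂ + Rs₂), cD * (Rm₃ + Rs₃)]
  let V : Fin 8 → ℕ → ℝ :=
    ![gate (lconv ((Mm₁ + Ms₁) + (Mm₂ + Ms₂)) (Mm₃ + Ms₃) (lconv (Mm₁ + Ms₁) (Mm₂ + Ms₂) ρ₁ ρ₂) ρ₃) (a * q),
      lconv ((Mm₁ + Ms₁) + (Mm₂ + Ms₂)) (Mm₃ + Ms₃) (lconv (Mm₁ + Ms₁) (Mm₂ + Ms₂) (gate ρ₁ (a * q)) (gate ρ₂ (a * q))) (gate ρ₃ (a * q)),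
      lconv ((Mm₁ + Ms₁) + (Mm₂ + Ms₂)) (Mm₃ + Ms₃) (lconv (Mm₁ + Ms₁) (Mm₂ + Ms₂) (gate ρ₁m τ₁) ρ₂) ρ₃,
      lconv ((Mm₁ + Ms₁) + (Mm₂ + Ms₂)) (Mm₃ + Ms₃) (lconv (Mm₁ + Ms₁) (Mm₂ + Ms₂) ρ₁ (gate ρ₂m τ₂)) ρ₃,
      lconv ((Mm₁ + Ms₁) + (Mm₂ + Ms₂)) (Mm₃ + Ms₃) (lconv (Mm₁ + Ms₁) (Mm₂ + Ms₂) ρ₁ ρ₂) (gate ρ₃m τ₃),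
      lconv ((Mm₁ + Ms₁) + (Mm₂ + Ms₂)) (Mm₃ + Ms₃) (lconv (Mm₁ + Ms₁) (Mm₂ + Ms₂) (gate ν₁ t₁) ρ₂) ρ₃,
      lconv ((Mm₁ + Ms₁) + (Mm₂ + Ms₂)) (Mm₃ + Ms₃) (lconv (Mm₁ + Ms₁) (Mm₂ + Ms₂) ρ₁ (gate ν₂ t₂)) ρ₃,
      lconv ((Mm₁ + Ms₁) + (Mm₂ + Ms₂)) (Mm₃ + Ms₃) (lconv (Mm₁ + Ms₁) (Mm₂ + Ms₂) ρ₁ ρ₂) (gate ν₃ t₃)]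
  have hW0 : ∀ i, 0 ≤ W i := by
    have e₂ : 0 ≤ cU * Rm₁ := mul_nonneg hcU0 hRm₁0.le
    have e₃ : 0 ≤ cU * Rm₂ := mul_nonneg hcU0 hRm₂0.le
    have e₄ : 0 ≤ cU * Rm₃ := mul_nonneg hcU0 hRm₃0.le
    have e₅ : 0 ≤ cD * (Rm₁ + Rs₁) := mul_nonneg hcD0 hRp₁0.le
    have e₆ : 0 ≤ cD * (Rm₂ + Rs₂) := mul_nonneg hcD0 hRp₂0.le
    have e₇ : 0 ≤ cD * (Rm₃ + Rs₃) := mul_nonneg hcD0 hRp₃0.le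
    intro i
    fin_cases i <;> [exact hwN0; exact hwP0; exact e₂; exact e₃; exact e₄; exact e₅; exact e₆; exact e₇]
  have hW1 : ∑ i, W i = 1 := by
    rw [Fin.sum_univ_eight]
    show wN + wP + cU * Rm₁ + cU * Rm₂ + cU * Rm₃ + cD * (Rm₁ + Rs₁) + cD * (Rm₂ + Rs₂) + cD * (Rm₃ + Rs₃) = 1
    linear_combination hsum
  have hdec : ∀ i, 0 < W i → DECAtT (a * q * y) (a * q * ((Rm₁ + s * Rs₁) + (Rm₂ + s * Rs₂) + (Rm₃ + s * Rs₃))) j ((Mm₁ + Ms₁) + (Mm₂ + Ms₂) + (Mm₃ + Ms₃)) (V i) := by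
    intro i _
    fin_cases i <;> [exact dN; exact dP; exact dU₁; exact dU₂; exact dU₃; exact dD₁; exact dD₂; exact dD₃]
  have hμ : ∀ h, gate (lconv ((Mm₁ + Ms₁) + (Mm₂ + Ms₂)) (Mm₃ + Ms₃)
        (lconv (Mm₁ + Ms₁) (Mm₂ + Ms₂) (gate ρ₁ q) (gate ρ₂ q)) (gate ρ₃ q)) a h = ∑ i, W i * V i h := by
    intro h
    have I := tiedCore_gateCoupling_general (Mm₁ + Ms₁) (Mm₂ + Ms₂) (Mm₃ + Ms₃) ρ₁ ρ₂ ρ₃ ρ₁m ρ₂m ρ₃m ν₁ ν₂ ν₃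
      q s a Rm₁ Rm₂ Rm₃ Rs₁ Rs₂ Rs₃ p₁M p₂M p₃M hsp₁ hsp₂ hsp₃ hmne hs0.ne' hRm₁0.ne' hRm₂0.ne' hRm₃0.ne'
      hRp₁0.ne' hRp₂0.ne' hRp₃0.ne' hSig0.ne' h
    rw [gτ₁, gτ₂, gτ₃, gt₁, gt₂, gt₃] at I
    rw [Fin.sum_univ_eight, I]
    simp only [W, V, Matrix.cons_val]
    rw [hwN, hwP, hcU, hcD]
    ring
  -- the mean of the gated forest is the target
  obtain ⟨_, _, tq₁1⟩ := gate_laws (Mm₁ + Ms₁) ρ₁ q hq0.le hq1.le p₁0 p₁M p₁1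
  obtain ⟨_, _, tq₂1⟩ := gate_laws (Mm₂ + Ms₂) ρ₂ q hq0.le hq1.le p₂0 p₂M p₂1
  obtain ⟨_, _, tq₃1⟩ := gate_laws (Mm₃ + Ms₃) ρ₃ q hq0.le hq1.le p₃0 p₃M p₃1
  obtain ⟨_, _, _, _, tq₁₂1, _⟩ := (TreeBuiltN.conv (TreeBuiltN.gate q hq0 hq1 hρ₁) (TreeBuiltN.gate q hq0 hq1 hρ₂)).lawFacts
  have hmean : ∑ h ∈ Finset.range (((Mm₁ + Ms₁) + (Mm₂ + Ms₂) + (Mm₃ + Ms₃)) + 1), (h : ℝ) * gate (lconv ((Mm₁ + Ms₁) + (Mm₂ + Ms₂)) (Mm₃ + Ms₃)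
      (lconv (Mm₁ + Ms₁) (Mm₂ + Ms₂) (gate ρ₁ q) (gate ρ₂ q)) (gate ρ₃ q)) a h = (a * q * ((Rm₁ + s * Rs₁) + (Rm₂ + s * Rs₂) + (Rm₃ + s * Rs₃))) := by
    rw [sum_mul_gate, sum_mul_lconv _ _ _ _ tq₁₂1 tq₃1, sum_mul_lconv _ _ _ _ tq₁1 tq₂1, sum_mul_gate, sum_mul_gate, sum_mul_gate,
      hmean₁, hmean₂, hmean₃]
    ring
  rw [decAt_iff_decAtT, hmean]
  exact decAtT_finite_mixture (a * q * y) (a * q * ((Rm₁ + s * Rs₁) + (Rm₂ + s * Rs₂) + (Rm₃ + s * Rs₃))) j ((Mm₁ + Ms₁) + (Mm₂ + Ms₂) + (Mm₃ + Ms₃)) _ W V hW0 hW1 hμ hdec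

end LawDec

end Quant

end Summit.CriticalPhenomena.PercolationContinuityZ3.Theorems
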